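import Summits.CriticalPhenomena.Ising3DConformalLimit.Theorems.EnergyNotSigmaSquaredGapForcesFarMergingScreeningDefsUnpin
import Summits.CriticalPhenomena.Ising3DConformalLimit.Theorems.EnergyNotSigmaSquaredGapForcesFarMergingRootOpacity
import HarnessLib

/-! # Root opacity at every aspect — the counting with the top octaves excluded
(line `screening-form-lemma-a1` of crux `GapForcesFarMerging`, item stmt-CriticalPhenomena-4468;
registered helper `rootOpacityFar_of_floors` of the lead's large-aspect reshape of the far end,
glue `farScreening_of_unpinFar : HazardRelocationFar → UnpinFlex → RootOpacityFarIO → FarScreeningIO`)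

Write `A(r;m) = pinchScreen n r m` (box size `n` large). The landed counting
`rootOpacity_of_floors_rootFloor` (file `…RootOpacityCounting`) finds, along each decay scale
`m ∈ [2^{K+3}, 2^{K+4})`, an opaque windowed octave `k ∈ [j₀, K)` of the ladder: the root floor
`A(2^{j₀};m) ≥ η`, the octave floors `A(2^{j+1};m) ≥ δ A(2^j;m)` (`j₀ ≤ j < K`), the bulk floor and the
decay `A(n;m) ≤ C m^{-κ}` force `P·N + q ≥ K - j₀` drop octaves (`A(2^{j+1};m) ≤ λ A(2^j;m)`,
`λ = 2^{-κ/2}`, `λ^{P+1} ≤ δ`; `ladder_twoRate_le`, `drops_count`), while with `θ = 4^{-14P}` at most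
`7(K + 3 + q')/(14P)` octaves below `K` have no `θ`-doubling window (`bad_steps_bound`, `card_noWindow_le`).
Here the SAME counting is run with the admissible octaves cut down to `k + A ≤ K + 3` (so that the far scale
sits at aspect `≥ 2^A` above the octave: `2^{k+A} ≤ 2^{K+3} ≤ m`): this excludes at most `A` further indices,
which is absorbed by taking the decay scale beyond a threshold `K₀(A)` — legitimate because in
`RootOpacityFarIO` the constants `c = 1 - λ`, `θ = 4^{-14P}` are fixed BEFORE `A` and do not depend on it,
while `∃ᶠ k` is proved through `Filter.frequently_atTop` after `A` is given. Fed with the landed root floor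
`rootFloor` at every root octave this gives the registered helper
`rootOpacityFar_of_floors : OnePinchScreeningDecay → Floors → RootOpacityFarIO`, which makes the certificate
`crux ⇐ Floors ∧ HazardRelocationFar ∧ UnpinFlex` of the line available.
References: Aizenman–Duminil-Copin 2021 (arXiv:1912.07973), Def. 5.11 (regular scales); Simon 1980 /
Lieb 1980 (the dyadic lower bound behind `bad_steps_bound`); the counting is elementary. -/

noncomputable section

namespace Summit.CriticalPhenomena.Ising3DConformalLimit.EnergyNotSigmaSquaredGapForcesFarMerging

open scoped symmDiff ENNReal
open MeasureTheory Filter Finset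
open Literature.Probability.LatticeModels Literature.Probability.Percolation
open Summit.CriticalPhenomena.Ising3DConformalLimit.Theorems.GapForcesFarMerging.Negative (e₁ e₂ cc2 xR up dn)
open Summit.CriticalPhenomena.Ising3DConformalLimit.GapForcesFarMergingScreening

/-! ### The counting theorem at every aspect -/

/-- **Root opacity at every aspect from decay, floors and a root floor.**
If the one-pinch screening ladder `A(r;m) = pinchScreen n r m` has (i) a ROOT FLOOR `A(2^{j₀};m) ≥ η > 0`
for large `m` and large `n`, at infinitely many root octaves `j₀`; (ii) the decay `A(n;m) ≤ C m^{-κ}` along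
infinitely many `m` (`OnePinchScreeningDecay`); (iii) the octave and bulk floors (`Floors`) — then with
`1 - c = 2^{-κ/2}` and `θ = 4^{-14P}` (`2^{-(P+1)κ/2} ≤ δ`), for EVERY aspect `A`, infinitely many octaves
`k` in a `θ`-doubling window carry a far scale `m ≥ 2^{k+A}` with a relative drop
`A(2^{k+1};m) ≤ (1-c)A(2^k;m)`, `A(2^k;m) > 0`, for infinitely many box sizes (`RootOpacityFarIO`):
the counting of `rootOpacity_of_floors_rootFloor` restricted to the octaves `k ≤ K + 3 - A` of a decay
scale `m ∈ [2^{K+3}, 2^{K+4})`, `K ≥ K₀(A)`. [folklore] -/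
theorem rootOpacityFar_of_floors_rootFloor :
    (∃ᶠ j₀ : ℕ in atTop, ∃ η : ℝ, 0 < η ∧
      ∀ᶠ m : ℕ in atTop, ∀ᶠ n : ℕ in atTop, η ≤ pinchScreen n (2 ^ j₀) m) →
    OnePinchScreeningDecay → Floors → RootOpacityFarIO := by
  -- adapted from `rootOpacity_of_floors_rootFloor` (…RootOpacityCounting.lean): one more family of
  -- excluded indices (`K + 3 < k + A`, at most `A` of them) and the threshold `K₀` enlarged by `2PA`
  intro hRoot hDecay hFloors
  classical
  obtain ⟨κ, C, hκ, hfreq⟩ := hDecay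
  obtain ⟨δ, hδ, hoct, hbulk⟩ := hFloors
  -- the drop rate `λ = 2^{-κ/2}` (`c = 1 - λ`) and `P` with `λ^{P+1} ≤ δ`
  set lam : ℝ := (2 : ℝ) ^ (-(κ / 2)) with hlam
  have hlam0 : 0 < lam := Real.rpow_pos_of_pos two_pos _
  have hlam1 : lam < 1 := Real.rpow_lt_one_of_one_lt_of_neg one_lt_two (by linarith)
  obtain ⟨P, hP⟩ : ∃ P : ℕ, lam ^ (P + 1) ≤ δ := by
    obtain ⟨p, hp⟩ := exists_pow_lt_of_lt_one hδ hlam1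
    exact ⟨p, (pow_le_pow_of_le_one hlam0.le hlam1.le (Nat.le_succ p)).trans hp.le⟩
  -- the window constants: Simon–Lieb `c₁`, `4^{-q'} ≤ c₁`, `θ = 4^{-T}`, `T = 14P`
  obtain ⟨c₁, hc₁pos, hc₁⟩ := exists_dyadic_lower
  obtain ⟨q', hq'⟩ := exists_pow_lt_of_lt_one hc₁pos (by norm_num : (1 / 4 : ℝ) < 1)
  set T : ℕ := 14 * P with hT
  refine ⟨1 - lam, (1 / 4 : ℝ) ^ T, by linarith, by positivity, ?_⟩
  -- thresholds: octave floors beyond `j₁`, a root floor at `j₀ ≥ j₁` for `m ≥ m₁`, bulk floors beyond `k₁`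
  obtain ⟨j₁, hj₁⟩ := Filter.eventually_atTop.1 hoct
  obtain ⟨j₀, hj₀, η, hη, hroot⟩ := hRoot.forall_exists_of_atTop j₁
  obtain ⟨m₁, hm₁⟩ := Filter.eventually_atTop.1 hroot
  obtain ⟨k₁, hk₁⟩ := Filter.eventually_atTop.1 hbulk
  -- `C₂ λ^q ≤ 1`, `C₂ = max C 1 / (δ η)`
  set C₂ : ℝ := max C 1 / (δ * η) with hC₂
  have hC₂pos : 0 < C₂ := by positivity
  obtain ⟨q, hq⟩ : ∃ q : ℕ, C₂ * lam ^ q ≤ 1 := by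
    obtain ⟨q, hq⟩ := exists_pow_lt_of_lt_one (inv_pos.2 hC₂pos) hlam1
    exact ⟨q, (mul_le_mul_of_nonneg_left hq.le hC₂pos.le).trans_eq (mul_inv_cancel₀ hC₂pos.ne')⟩
  -- the aspect `A` is given only now: the constants above do not depend on it, the threshold `K₀` does
  intro A
  refine Filter.frequently_atTop.2 fun k₀ => ?_
  -- a decay scale `m ∈ [2^{K+3}, 2^{K+4})` with `K ≥ K₀`
  set K₀ : ℕ := 2 * j₀ + 2 * q + 2 * (P * k₀) + 2 * (P * A) + q' + k₁ + 4 with hK₀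
  obtain ⟨m, hmge, hm⟩ := hfreq.forall_exists_of_atTop (max (2 ^ (K₀ + 3)) m₁)
  have hm2 : 2 ^ (K₀ + 3) ≤ m := le_of_max_le_left hmge
  have hmm₁ : m₁ ≤ m := le_of_max_le_right hmge
  have hm0 : m ≠ 0 := by have := Nat.one_le_two_pow (n := K₀ + 3); omega
  obtain ⟨K, hK⟩ : ∃ K : ℕ, K = Nat.log 2 m - 3 := ⟨_, rfl⟩
  have hlogK₀ : K₀ + 3 ≤ Nat.log 2 m := Nat.le_log_of_pow_le one_lt_two hm2
  have hmK : 2 ^ (K + 3) ≤ m := (show K + 3 = Nat.log 2 m by omega) ▸ Nat.pow_log_le_self 2 hm0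
  have hmK' : m < 2 ^ (K + 4) :=
    (show Nat.log 2 m + 1 = K + 4 by omega) ▸ Nat.lt_pow_succ_log_self one_lt_two m
  have hK₀K : K₀ ≤ K := by omega
  -- the large box sizes: decay at `m`, bulk floor at `(K,m)`, octave floors on `[j₀,K)`, root floor at `j₀`
  have hE : ∀ᶠ n : ℕ in atTop, pinchScreen n n m ≤ C * (m : ℝ) ^ (-κ) ∧
      δ * pinchScreen n (2 ^ K) m ≤ pinchScreen n n m ∧
      (∀ j ∈ Ico j₀ K, δ * pinchScreen n (2 ^ j) m ≤ pinchScreen n (2 ^ (j + 1)) m) ∧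
      η ≤ pinchScreen n (2 ^ j₀) m := by
    refine hm.and ((hk₁ K (by omega) m hmK hmK').and
      (((Filter.eventually_all_finset _).2 fun j hj => ?_).and (hm₁ m hmm₁)))
    rw [mem_Ico] at hj
    refine hj₁ j (by omega) m ?_
    calc 2 ^ (j + 4) ≤ 2 ^ (K + 3) := Nat.pow_le_pow_right (by norm_num) (by omega)
      _ ≤ m := hmK
  -- for each such `n`: an opaque, windowed octave `k ∈ [j₀, K)` with `k ≥ k₀` AND `k + A ≤ K + 3`
  have hstep : ∀ᶠ n : ℕ in atTop, ∃ k ∈ Ico j₀ K, k₀ ≤ k ∧ k + A ≤ K + 3 ∧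
      DoublingWindow ((1 / 4 : ℝ) ^ T) k ∧
      0 < pinchScreen n (2 ^ k) m ∧
      pinchScreen n (2 ^ (k + 1)) m ≤ lam * pinchScreen n (2 ^ k) m := by
    filter_upwards [hE] with n hn
    obtain ⟨hdec, hblk, hoctn, hrt⟩ := hn
    -- the ladder `a i = A(2^{j₀+i}; m)`, `i ≤ t = K - j₀`
    obtain ⟨a, ha⟩ : ∃ a : ℕ → ℝ, ∀ i, a i = pinchScreen n (2 ^ (j₀ + i)) m := ⟨_, fun _ => rfl⟩
    obtain ⟨t, ht⟩ : ∃ t : ℕ, t = K - j₀ := ⟨_, rfl⟩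
    have hfl : ∀ i < t, δ * a i ≤ a (i + 1) := fun i hi => by
      rw [ha, ha]
      exact hoctn (j₀ + i) (mem_Ico.2 ⟨by omega, by omega⟩)
    have ha0 : 0 < a 0 := by rw [ha]; exact lt_of_lt_of_le hη hrt
    have hpos : ∀ i ≤ t, 0 < a i := fun i hi =>
      ladder_pos a hδ ha0 i fun i' hi' => hfl i' (by omega)
    have hlow := ladder_twoRate_le a hδ.le hlam0.le t hfl
    set N := #((range t).filter fun i => a (i + 1) ≤ lam * a i) with hN
    have hNt : N ≤ t := (card_filter_le _ _).trans (card_range t).le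
    have hat : a t = pinchScreen n (2 ^ K) m := by
      rw [ha, show j₀ + t = K by omega]
    -- the squeeze `δ^N λ^{t-N} ≤ C₂ λ^{2t}`
    have hdecay' : pinchScreen n n m ≤ max C 1 * lam ^ (2 * (K + 3)) := by
      have h1 : (m : ℝ) ^ (-κ) ≤ ((2 : ℝ) ^ (K + 3)) ^ (-κ) :=
        Real.rpow_le_rpow_of_nonpos (by positivity) (by exact_mod_cast hmK) (by linarith)
      have h2 : ((2 : ℝ) ^ (K + 3)) ^ (-κ) = lam ^ (2 * (K + 3)) := by
        rw [hlam, ← Real.rpow_natCast (2 : ℝ) (K + 3), ← Real.rpow_mul (by norm_num : (0 : ℝ) ≤ 2),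
          ← Real.rpow_natCast ((2 : ℝ) ^ (-(κ / 2))) (2 * (K + 3)),
          ← Real.rpow_mul (by norm_num : (0 : ℝ) ≤ 2)]
        congr 1; push_cast; ring
      calc pinchScreen n n m ≤ C * (m : ℝ) ^ (-κ) := hdec
        _ ≤ max C 1 * (m : ℝ) ^ (-κ) := mul_le_mul_of_nonneg_right (le_max_left _ _) (by positivity)
        _ ≤ max C 1 * ((2 : ℝ) ^ (K + 3)) ^ (-κ) := mul_le_mul_of_nonneg_left h1 (by positivity)
        _ = max C 1 * lam ^ (2 * (K + 3)) := by rw [h2]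
    have hsq : δ ^ N * lam ^ (t - N) ≤ C₂ * lam ^ (2 * t) := by
      have h1 : δ ^ N * lam ^ (t - N) * η ≤ a t :=
        (mul_le_mul_of_nonneg_left (hrt.trans_eq (ha 0).symm) (by positivity)).trans hlow
      have h2 : δ * a t ≤ max C 1 * lam ^ (2 * t) := by
        rw [hat]
        calc δ * pinchScreen n (2 ^ K) m ≤ pinchScreen n n m := hblk
          _ ≤ max C 1 * lam ^ (2 * (K + 3)) := hdecay'
          _ ≤ max C 1 * lam ^ (2 * t) :=
            mul_le_mul_of_nonneg_left (pow_le_pow_of_le_one hlam0.le hlam1.le (by omega))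
              (by positivity)
      rw [hC₂, div_mul_eq_mul_div, le_div_iff₀ (by positivity)]
      calc δ ^ N * lam ^ (t - N) * (δ * η) = δ * (δ ^ N * lam ^ (t - N) * η) := by ring
        _ ≤ δ * a t := mul_le_mul_of_nonneg_left h1 hδ.le
        _ ≤ max C 1 * lam ^ (2 * t) := h2
    have hcount : t ≤ P * N + q := drops_count hlam0 hlam1 hP hq hNt hsq
    -- windows: few bad steps, few octaves without a window
    have hbad := bad_steps_bound hc₁ hq'.le T (K + 3)
    have hwin := card_noWindow_le ((1 / 4 : ℝ) ^ T) K
    set b := #((range (K + 3)).filter fun j => criticalTwoPoint 3 (((2 : ℤ) ^ (j + 1)) • e₁) <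
        (1 / 4 : ℝ) ^ T * criticalTwoPoint 3 (((2 : ℤ) ^ j) • e₁)) with hb
    -- the excluded indices `i < t`: `j₀ + i < k₀`, or `j₀ + i` among the top `A` octaves (`K + 3 < j₀ + i + A`),
    -- or no window at `j₀ + i`
    set X := (range t).filter fun i =>
        j₀ + i < k₀ ∨ K + 3 < j₀ + i + A ∨ ¬DoublingWindow ((1 / 4 : ℝ) ^ T) (j₀ + i) with hX
    have hXcard : #X ≤ k₀ + A + 7 * b := by
      have hX1 : #((range t).filter fun i => j₀ + i < k₀) ≤ k₀ :=
        calc #((range t).filter fun i => j₀ + i < k₀) ≤ #(range k₀) :=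
              card_le_card_of_injOn (fun i => j₀ + i)
                (fun i hi => by
                  simp only [Finset.mem_coe, mem_filter, mem_range] at hi ⊢
                  omega)
                (fun i _ i' _ h => Nat.add_left_cancel h)
          _ = k₀ := card_range k₀
      have hX3 : #((range t).filter fun i => K + 3 < j₀ + i + A) ≤ A :=
        calc #((range t).filter fun i => K + 3 < j₀ + i + A) ≤ #(Ico (t - A) t) :=
              card_le_card fun i hi => by
                rw [mem_filter, mem_range] at hi
                rw [mem_Ico]; omega
          _ ≤ A := by rw [Nat.card_Ico]; omega
      have hX2 : #((range t).filter fun i => ¬DoublingWindow ((1 / 4 : ℝ) ^ T) (j₀ + i)) ≤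
          #((range K).filter fun k => ¬DoublingWindow ((1 / 4 : ℝ) ^ T) k) :=
        card_le_card_of_injOn (fun i => j₀ + i)
          (fun i hi => by
            simp only [Finset.mem_coe, mem_filter, mem_range] at hi ⊢
            exact ⟨by omega, hi.2⟩)
          (fun i _ i' _ h => Nat.add_left_cancel h)
      calc #X ≤ #((range t).filter fun i => j₀ + i < k₀) +
            (#((range t).filter fun i => K + 3 < j₀ + i + A) +
              #((range t).filter fun i => ¬DoublingWindow ((1 / 4 : ℝ) ^ T) (j₀ + i))) := by
            rw [hX, filter_or, filter_or]
            exact (card_union_le _ _).trans (Nat.add_le_add_left (card_union_le _ _) _)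
        _ ≤ k₀ + (A + 7 * b) := add_le_add hX1 (add_le_add hX3 (hX2.trans hwin))
        _ = k₀ + A + 7 * b := (add_assoc _ _ _).symm
    -- counting: more drops than excluded indices
    have hNX : #X < N := by
      by_contra hle
      push Not at hle
      have h1 : P * N ≤ P * k₀ + P * A + 7 * (P * b) :=
        calc P * N ≤ P * (k₀ + A + 7 * b) := Nat.mul_le_mul_left P (hle.trans hXcard)
          _ = P * k₀ + P * A + 7 * (P * b) := by ring
      have h2 : 14 * (P * b) ≤ K + 3 + q' := by simpa only [hT, mul_assoc] using hbad
      omega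
    obtain ⟨i, hiD, hiX⟩ := exists_mem_notMem_of_card_lt_card hNX
    rw [mem_filter, mem_range] at hiD
    have hiX' : ¬(j₀ + i < k₀ ∨ K + 3 < j₀ + i + A ∨ ¬DoublingWindow ((1 / 4 : ℝ) ^ T) (j₀ + i)) :=
      fun h => hiX (mem_filter.2 ⟨mem_range.2 hiD.1, h⟩)
    push Not at hiX'
    refine ⟨j₀ + i, mem_Ico.2 ⟨by omega, by omega⟩, hiX'.1, hiX'.2.1, hiX'.2.2, ?_, ?_⟩
    · rw [← ha]; exact hpos i hiD.1.le
    · have h := hiD.2; rw [ha, ha] at h; exact h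
  -- pigeonhole over `k ∈ [j₀, K)`, then read off `RootOpacityFarIO` at this `k` and `m` (`2^{k+A} ≤ 2^{K+3} ≤ m`)
  obtain ⟨k, -, hfr⟩ := exists_frequently_of_eventually_exists _ hstep
  obtain ⟨-, hkk₀, hkA, hkw, -, -⟩ := hfr.exists
  refine ⟨k, hkk₀, hkw, m, ?_, hfr.mono fun n hn => ⟨hn.2.2.2.1, ?_⟩⟩
  · calc 2 ^ (k + A) ≤ 2 ^ (K + 3) := Nat.pow_le_pow_right (by norm_num) hkA
      _ ≤ m := hmK
  · rw [sub_sub_cancel]; exact hn.2.2.2.2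

/-- **ROOT OPACITY AT EVERY ASPECT (registered helper `rootOpacityFar_of_floors`)**: one-pinch screening decay and
the floors force, with constants `c, θ > 0` fixed first, for EVERY aspect `A`, infinitely many octaves `k` inside a
`θ`-doubling window of the critical two-point function with a far scale `m ≥ 2^{k+A}` carrying a relative screening
drop `A(2^{k+1};m) ≤ (1-c)A(2^k;m)`, `A(2^k;m) > 0`, for infinitely many box sizes: the counting
`rootOpacityFar_of_floors_rootFloor` fed with the landed root floor `rootFloor` (ADC21 Lemma A.1 side) at every
root octave. [folklore] -/
theorem rootOpacityFar_of_floors : OnePinchScreeningDecay → Floors → RootOpacityFarIO := fun hD hF =>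
  rootOpacityFar_of_floors_rootFloor (Filter.Eventually.of_forall rootFloor).frequently hD hF

end Summit.CriticalPhenomena.Ising3DConformalLimit.EnergyNotSigmaSquaredGapForcesFarMerging

end
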